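/-
Copyright (c) 2026. All rights reserved.
Released under Apache 2.0 license as described in the file LICENSE.
Authors: abc-iut cell, prover seat abc-iut-L4-t5 (gen 10; row «F3757-PORT», abc-iut-L4-lead m147 (5)), after abc-iut-L4-t8's
`LogFrobeniusMonoTelecoreObservablesGenuineOpen.lean` (the mono-analytic twin at the same carrier); every carrier-side input is
consumed BY NAME (abc-iut-f-101, abc-iut-w5-d053, abc-iut-w5-d144, abc-iut-L4-t3 lineages) — nothing of those files is re-meant.
-/
import Literature.AnabelianGeometry.AbsoluteAnabelian.LogFrobeniusAnTelecoreObservablesOf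
import Literature.AnabelianGeometry.AbsoluteAnabelian.LogFrobeniusAnTelecoreObservablesOverBridge
import Literature.AnabelianGeometry.AbsoluteAnabelian.LogFrobeniusMonoTelecoreGenuineOpen
import Literature.AnabelianGeometry.AbsoluteAnabelian.LogFrobeniusMonoGenuineSubIotaOver
import Literature.AnabelianGeometry.AbsoluteAnabelian.LogFrobeniusMonoGenuineIotaOverTS
import Literature.AnabelianGeometry.AbsoluteAnabelian.LogFrobeniusMonoGenuineSubHolomorphicOver
import Literature.AnabelianGeometry.AbsoluteAnabelian.LogFrobeniusMonoGenuineSubObservablesTS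
import Literature.AnabelianGeometry.AbsoluteAnabelian.LogFrobeniusObservablesTSPushSubFamily
import HarnessLib

/-!
# [AbsTopIII] Cor 5.5 (iii), last sentence: `𝔗_{An•}`, the core at `ℰ•`, `S_log`, `S_log⊞` are compatible — AT THE GENUINE OPEN-AUGMENTATION CARRIER

S. Mochizuki, *Topics in absolute anabelian geometry III: global reconstruction algorithms* [MochizukiAbsTopIII2015]; locators
`p.N` = pages of the author's manuscript (`paper:url-5493eb38cbb7`), read on the page: Cor 5.5 (iii) p. 131 ("the families of
homotopies that constitute `S_log` and `S_log⊞` are compatible with one another as well as with the families of homotopies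
that constitute the core and telecore structures of (i), (ii)"), Def 3.5 (ii) p. 75 ("compatible").

PROOF-ONLY file (row «F3757-PORT», file 10 of the mover — FACT-LIST F-3757 at the genuine carrier).  abc-iut-w5-d144 typed the
last sentence of Cor 5.5 (iii), inside `D_{An•}`, as the assumption `Cor55ObservablesTelecoreCompatible L TS`; file 8 proved the
SUFFICIENCY theorem `cor55ObservablesTelecoreCompatible_of` (observable families `Hplus`, `Hts`, push `hpush`, over-ness
`hoverPlus` / `hoverTS` read in `D_{An•}` against `anOverE`, reflexivity `hreflPlus` / `hreflTS`, observability `hobs`) and file 9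
the bridges `hoverPlus_of_isOver` / `hoverTS_of_isOver` from the observables' own over-data.  HERE every binder is DISCHARGED at
abc-iut-f-101's genuine open-augmentation carrier `genuineOpen p V` (𝒳 = `TFModel p` with open augmentations; `V(F_mod) ≠ ∅`,
all places nonarchimedean) with ANY `TS`-datum `T` whose `ι` lie over `Th•[Z]` (`T.IotaOverTS`), in particular the carrier's own
`genuineOpenTS p V`:
* `Hplus v :=` abc-iut-L4-t5's `logObsFamily v` (abc-iut-w5-d053's `genuineOpen_iotaSquaresCommute`), `Hts v := logObsFamilyTS v T`
  (`genuineOpen_iotaSquaresCommuteTS`), `hpush :=` abc-iut-w5-d144's `subFamily_pushFamily_logObsFamilyTS`, `hobs :=`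
  `genuineOpen_isLogObservable_pair`, `hreflPlus` / `hreflTS` := the empty chain (`chainFamily`'s boundary set is reflexive on
  the paths into the observation vertex);
* `hoverPlus` / `hoverTS` := the bridges over abc-iut-w5-d144's `isOver_logObsFamily_η` / `isOver_logObsFamilyTS_η` (inputs
  `IotaOver`, `LamOverLink` of the carrier — abc-iut-f-101's `nonarchGenuineMonoAnPfOpen_iotaOver` / `_lamOverLink` — and
  `T.IotaOverTS`).
Results: `genuineOpen_hoverPlus`, `genuineOpen_hoverTS`; ★ `cor55ObservablesTelecoreCompatible_genuineOpen_of_iotaOverTS` (every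
`T` with `T.IotaOverTS`); ★★ `cor55ObservablesTelecoreCompatible_genuineOpen` (the carrier's own `TS`-datum; zero hypotheses
beyond `V ≠ ∅`); `…_iff` (⟺ `V ≠ ∅`, abc-iut-w5-d144's degenerate corner); `exists_genuine_cor55ObservablesTelecoreCompatible`.
HONEST LABEL: MODEL-LEVEL at a genuine carrier of the cell's own construction (nonarchimedean index sets); the typed statement is
abc-iut-w5-d144's reading of the printed sentence; refereed pre-IUT material; nothing here bears on [IUTchIII] Cor. 3.12; no side
taken; typed ≠ proved elsewhere.
-/

set_option autoImplicit false

universe u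

open CategoryTheory Quiver

namespace Literature.AnabelianGeometry.AbsoluteAnabelian

namespace LogFrobeniusSetting

open AbsTopIII DiagramOfCategories

/-! ## Reflexivity of the constructed observables' boundary sets -/

section Refl

variable {Vmod : Type u} {isArc : Vmod → Bool} (L : LogFrobeniusSetting Vmod isArc) (v : Vmod)

/-- The boundary set of the constructed `S_log⊞_v` contains every diagonal pair into `𝒩⊞_v` (the empty chain).
[cite: MochizukiAbsTopIII2015, Definition 3.5 (ii) p.75] -/
theorem logObsFamily_E_refl (hsq : L.IotaSquaresCommute v) {a : (logShapePlus (isArc := isArc) v).Vertex}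
    (p : Path a (logShapePlus (isArc := isArc) v).obs) : (L.logObsFamily v hsq).E p p :=
  ⟨rfl, ⟨Chain.nil p⟩⟩

/-- The boundary set of the constructed `S_log_v` contains every diagonal pair into `𝒩_v`.
[cite: MochizukiAbsTopIII2015, Definition 3.5 (ii) p.75] -/
theorem logObsFamilyTS_E_refl (T : L.TSHomotopies) (hsq : L.IotaSquaresCommuteTS T v)
    {a : (logShapeTS (isArc := isArc) v).Vertex} (p : Path a (logShapeTS (isArc := isArc) v).obs) :
    (L.logObsFamilyTS v T hsq).E p p :=
  ⟨rfl, ⟨Chain.nil p⟩⟩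

end Refl

section Instance

variable (p : ℕ) [Fact p.Prime] (Vmod : Type 1)

/-- **`hoverPlus` at the genuine carrier**: every homotopy of the universal `⊞`-observable family `S_log⊞_v` of `genuineOpen p V`,
read inside `D_{An•}`, lies over `Th•[Z]` for file 1's `anOverE` — file 9's bridge over abc-iut-w5-d144's `isOver_logObsFamily_η`.
[cite: MochizukiAbsTopIII2015, Remark 3.5.1 p.78] -/
theorem genuineOpen_hoverPlus (v : Vmod) (a : (logShapePlus (isArc := fun _ : Vmod => false) v).Vertex)
    (q r : Path a (logShapePlus (isArc := fun _ : Vmod => false) v).obs)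
    (h : ((genuineOpen p Vmod).logObsFamily v (genuineOpen_iotaSquaresCommute p Vmod v)).E q r) :
    (genuineOpen p Vmod).anOverE.IsOver ((plusEmb (Vmod := Vmod) (isArc := fun _ => false) v).mapPath q)
      ((plusEmb (Vmod := Vmod) (isArc := fun _ => false) v).mapPath r)
      ((genuineOpen p Vmod).embPlusHomAn v
        ((genuineOpen p Vmod).logObsFamily v (genuineOpen_iotaSquaresCommute p Vmod v)) h) :=
  (genuineOpen p Vmod).isOver_embPlusHomAn_of_isOver v _ h
    ((genuineOpen p Vmod).isOver_logObsFamily_η v (nonarchGenuineMonoAnPfOpen_iotaOver p Vmod (fun _ => false))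
      (nonarchGenuineMonoAnPfOpen_lamOverLink p Vmod (fun _ => false)) _ h)

/-- **`hoverTS` at the genuine carrier**, for every `TS`-datum `T` whose `ι` lie over `Th•[Z]` (`T.IotaOverTS`).
[cite: MochizukiAbsTopIII2015, Remark 3.5.1 p.78] -/
theorem genuineOpen_hoverTS (T : (genuineOpen p Vmod).TSHomotopies) (hT : T.IotaOverTS) (v : Vmod)
    (a : (logShapeTS (isArc := fun _ : Vmod => false) v).Vertex)
    (q r : Path a (logShapeTS (isArc := fun _ : Vmod => false) v).obs)
    (h : ((genuineOpen p Vmod).logObsFamilyTS v T (genuineOpen_iotaSquaresCommuteTS p Vmod T v)).E q r) :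
    (genuineOpen p Vmod).anOverE.IsOver ((tsEmb (Vmod := Vmod) (isArc := fun _ => false) v).mapPath q)
      ((tsEmb (Vmod := Vmod) (isArc := fun _ => false) v).mapPath r)
      ((genuineOpen p Vmod).embTSHomAn v
        ((genuineOpen p Vmod).logObsFamilyTS v T (genuineOpen_iotaSquaresCommuteTS p Vmod T v)) h) :=
  (genuineOpen p Vmod).isOver_embTSHomAn_of_isOver v _ h
    ((genuineOpen p Vmod).isOver_logObsFamilyTS_η v T hT
      (nonarchGenuineMonoAnPfOpen_lamOverLink p Vmod (fun _ => false)) _ h)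

/-- ★ **Cor 5.5 (iii), last sentence, inside `D_{An•}`, AT THE GENUINE OPEN-AUGMENTATION CARRIER, for every `TS`-datum `T` with
`T.IotaOverTS`** (`V ≠ ∅`): ONE family of homotopies on `D_{An•}` contains the telecore family `𝒥` of `𝔗_{An•}`, the embedded core
family of `ℰ•` and the embedded `S_log⊞_v`, `S_log_v` at every `v` — file 8's sufficiency theorem with every binder discharged.
[cite: MochizukiAbsTopIII2015, Cor 5.5 (iii) p. 131] -/
theorem cor55ObservablesTelecoreCompatible_genuineOpen_of_iotaOverTS [Nonempty Vmod]
    (T : (genuineOpen p Vmod).TSHomotopies) (hT : T.IotaOverTS) :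
    (genuineOpen p Vmod).Cor55ObservablesTelecoreCompatible T :=
  (genuineOpen p Vmod).cor55ObservablesTelecoreCompatible_of
    (Hplus := fun v => (genuineOpen p Vmod).logObsFamily v (genuineOpen_iotaSquaresCommute p Vmod v))
    (Hts := fun v => (genuineOpen p Vmod).logObsFamilyTS v T (genuineOpen_iotaSquaresCommuteTS p Vmod T v))
    (hpush := fun v => (genuineOpen p Vmod).subFamily_pushFamily_logObsFamilyTS v T _ _)
    (hoverPlus := fun v a q r h => genuineOpen_hoverPlus p Vmod v a q r h)
    (hoverTS := fun v a q r h => genuineOpen_hoverTS p Vmod T hT v a q r h)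
    (hreflPlus := fun v _ q => (genuineOpen p Vmod).logObsFamily_E_refl v _ q)
    (hreflTS := fun v _ q => (genuineOpen p Vmod).logObsFamilyTS_E_refl v T _ q)
    (TS := T)
    (hobs := fun v => genuineOpen_isLogObservable_pair p Vmod T v)

/-- ★★ **Cor 5.5 (iii), last sentence, inside `D_{An•}`, AT THE GENUINE OPEN-AUGMENTATION CARRIER with its own `TS`-datum**
(`genuineOpenTS p V`; zero hypotheses beyond `V ≠ ∅`). [cite: MochizukiAbsTopIII2015, Cor 5.5 (iii) p. 131] -/
theorem cor55ObservablesTelecoreCompatible_genuineOpen [Nonempty Vmod] :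
    (genuineOpen p Vmod).Cor55ObservablesTelecoreCompatible (genuineOpenTS p Vmod) :=
  cor55ObservablesTelecoreCompatible_genuineOpen_of_iotaOverTS p Vmod (genuineOpenTS p Vmod) (genuineOpenTS_iotaOverTS p Vmod)

/-- **The statement at the genuine carrier EXACTLY**: it holds iff `V(F_mod) ≠ ∅` (abc-iut-w5-d144's
`not_cor55ObservablesTelecoreCompatible_of_isEmpty` is the degenerate corner). [cite: MochizukiAbsTopIII2015, Cor 5.5 (iii) p. 131] -/
theorem cor55ObservablesTelecoreCompatible_genuineOpen_iff :
    (genuineOpen p Vmod).Cor55ObservablesTelecoreCompatible (genuineOpenTS p Vmod) ↔ Nonempty Vmod := by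
  refine ⟨fun h => ?_, fun _ => cor55ObservablesTelecoreCompatible_genuineOpen p Vmod⟩
  by_contra hV
  haveI : IsEmpty Vmod := not_nonempty_iff.mp hV
  exact (genuineOpen p Vmod).not_cor55ObservablesTelecoreCompatible_of_isEmpty (genuineOpenTS p Vmod) h

end Instance

/-- Hence a §5 setting with `V(F_mod) ≠ ∅` and a `TS`-datum satisfying the typed Cor 5.5 (iii) telecore-compatibility clause
EXIST (model-level non-vacuity of abc-iut-w5-d144's `Cor55ObservablesTelecoreCompatible`). [cite: MochizukiAbsTopIII2015, Cor 5.5 (iii) p. 131] -/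
theorem exists_genuine_cor55ObservablesTelecoreCompatible (p : ℕ) [Fact p.Prime] (Vmod : Type 1) [Nonempty Vmod] :
    ∃ (L : LogFrobeniusSetting Vmod (fun _ => false)) (T : L.TSHomotopies), L.Cor55ObservablesTelecoreCompatible T :=
  ⟨genuineOpen p Vmod, genuineOpenTS p Vmod, cor55ObservablesTelecoreCompatible_genuineOpen p Vmod⟩

end LogFrobeniusSetting

end Literature.AnabelianGeometry.AbsoluteAnabelian
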